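import Summits.HubbardSuperconductivity.HubbardSuperconductivity.Theorems.AnisotropyChordSpinMonotoneResolventBranch

/-!
# Route `AnisotropyChord`: TOTAL POSITIVITY (TP₂) of the Gram kernel of a resolvent curve
# (LEMMA TP₂ of the theory seat `hubbard-h0-rotor-theory-1`, cycle 6 — the named first lemma of the
# total-positivity layer of the `U_vt` / TM-VT ladder; abstract linear algebra, no lattice)

**Cauchy–Gram kernel.**  For weights `w_j ≥ 0`, nodes `λ_j` and parameters `E, F` put
`K(E, F) = Σ_j w_j / ((λ_j − E)(λ_j − F))`.  This is the Gram kernel `⟨g_E, g_F⟩` of the resolvent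
curve `g_E = (J − E)⁻¹ v` of a real symmetric (or complex Hermitian) matrix `J` with eigenvalues
`λ_j`, `w_j = |⟨e_j, v⟩|²`.

* `cauchyGram_minor_nonneg` — **TP₂**: for `E ≤ E'` on the same side of every node carrying weight,
  and `F ≤ F'` likewise, `K(E,F') K(E',F) ≤ K(E,F) K(E',F')`.  Proof: Binet–Cauchy symmetrisation
  `2 (K(E,F)K(E',F') − K(E,F')K(E',F)) = Σ_i Σ_j w_i w_j (E'−E)(F'−F)(λ_i−λ_j)² / Π ≥ 0`, the
  `2 × 2` Cauchy determinant.  (S. Karlin, *Total Positivity* I (1968), Ch. 3 §1: the Cauchy kernel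
  `1/(x+y)` is totally positive; here only the order-2 minors, by hand.)
* `cauchyGram_nonneg`, `cauchyGram_pos` — TP₁ in a COMMON gap (`(λ_j − E)(λ_j − F) > 0`).
* `cauchyGram_mul_mono` — at the bottom of the spectrum (`λ_j ≥ 0`, parameters in `(0, λ_min⁺)`):
  `ε ↦ ε K(ε, F)` is non-decreasing (the `Δ = 1` end-point column of the two-magnon application).
* `resolventCurve_gram_tp2` — the real-symmetric matrix form (**LEMMA TP₂** as typed by the theory
  seat, `ResolventCurveGramTP2`, with its idle third gap conjunct dropped): solutions of
  `(J − E) g_E = v` have a TP₂ Gram kernel for parameters in common spectral gaps.  Spectral plumbing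
  over `Matrix.IsHermitian.eigenvectorUnitary`.
* `gram_tp2_of_rankOne_branch` — the complex Hermitian form along the GROUND BRANCH OF A RANK-ONE
  FAMILY `L + σ|s⟩⟨s|` on an `L`-invariant subspace `𝓜` (the setting of `…SpinMonotoneResolventBranch`,
  `L ⪰ 0`, `L e = 0`, `⟨e, s⟩ ≠ 0`): four states `ψᵢ ∈ 𝓜` with `L ψᵢ + σᵢ⟨s,ψᵢ⟩ s = εᵢ ψᵢ`, `σᵢ > 0`,
  `⟨s,ψᵢ⟩ ≠ 0`, each with the variational and the uniqueness property of its `εᵢ` on `𝓜 ∩ s^⊥`, and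
  `ε₂ ≤ ε₁`, `ε₄ ≤ ε₃`, satisfy `|⟨ψ₁,ψ₄⟩| |⟨ψ₂,ψ₃⟩| ≤ |⟨ψ₁,ψ₃⟩| |⟨ψ₂,ψ₄⟩|` — every `ψᵢ` is a
  multiple of the resolvent vector `(L − εᵢ)⁻¹ s` and all `εᵢ` lie in the first gap `(0, λ_min⁺)` of
  the cyclic spectrum.  This is the engine of COROLLARY TP-W2 (two-magnon ground-state curve on
  edge-transitive graphs, file `…SpinMonotoneTwoMagnonGramTP`).

Theory seat memo ROTOR-THEORY-6 §52, §56 P-2, §57 A (sketch file `Sketch6.lean`,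
`resolventCurveGramTP2_holds`, whose algebraic core is transplanted here).  B. Simon, *Trace Ideals*
(2005) §11 (rank-one perturbations); Karlin (1968).  No definition is introduced.
-/

set_option linter.dupNamespace false

noncomputable section

namespace Summit.HubbardSuperconductivity.HubbardSuperconductivity.Theorems.AnisotropyChord

open Matrix Complex Finset
open scoped ComplexOrder InnerProductSpace
open Literature.MathematicalPhysics.QuantumLattice

/-! ### The Cauchy–Gram kernel: TP₁ and TP₂ -/

/-- **TP₂ of the Cauchy–Gram kernel** `K(E,F) = Σ_j w_j/((λ_j − E)(λ_j − F))`: for weights `w ≥ 0`,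
`E ≤ E'` with `(λ_j − E)(λ_j − E') > 0` and `F ≤ F'` with `(λ_j − F)(λ_j − F') > 0` at every node
carrying weight, `K(E,F') K(E',F) ≤ K(E,F) K(E',F')`.  Binet–Cauchy symmetrisation and the `2 × 2`
Cauchy determinant.  Karlin, *Total Positivity* (1968) Ch. 3 §1. [folklore] -/
theorem cauchyGram_minor_nonneg {ι : Type*} [Fintype ι] (w lam : ι → ℝ) (hw : ∀ i, 0 ≤ w i)
    {E E' F F' : ℝ} (hE : E ≤ E') (hF : F ≤ F')
    (hgap : ∀ i, w i ≠ 0 → 0 < (lam i - E) * (lam i - E') ∧ 0 < (lam i - F) * (lam i - F')) :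
    (∑ i, w i / ((lam i - E) * (lam i - F'))) * (∑ i, w i / ((lam i - E') * (lam i - F))) ≤
      (∑ i, w i / ((lam i - E) * (lam i - F))) * (∑ i, w i / ((lam i - E') * (lam i - F'))) := by
  classical
  set a : ι → ℝ := fun i => w i / ((lam i - E) * (lam i - F)) with ha
  set d : ι → ℝ := fun i => w i / ((lam i - E') * (lam i - F')) with hd
  set b : ι → ℝ := fun i => w i / ((lam i - E) * (lam i - F')) with hb
  set c : ι → ℝ := fun i => w i / ((lam i - E') * (lam i - F)) with hc
  set T : ι → ι → ℝ := fun i j =>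
    w i * w j * ((E' - E) * (F' - F) * (lam i - lam j) ^ 2 /
      (((lam i - E) * (lam i - E')) * ((lam j - E) * (lam j - E')) *
        ((lam i - F) * (lam i - F')) * ((lam j - F) * (lam j - F')))) with hT
  have hTnn : ∀ i j, 0 ≤ T i j := by
    intro i j
    by_cases hi : w i = 0
    · simp [hT, hi]
    by_cases hj : w j = 0
    · simp [hT, hj]
    have hnum : 0 ≤ (E' - E) * (F' - F) * (lam i - lam j) ^ 2 :=
      mul_nonneg (mul_nonneg (sub_nonneg.mpr hE) (sub_nonneg.mpr hF)) (sq_nonneg _)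
    have hden : 0 < ((lam i - E) * (lam i - E')) * ((lam j - E) * (lam j - E')) *
        ((lam i - F) * (lam i - F')) * ((lam j - F) * (lam j - F')) :=
      mul_pos (mul_pos (mul_pos (hgap i hi).1 (hgap j hj).1) (hgap i hi).2) (hgap j hj).2
    exact mul_nonneg (mul_nonneg (hw i) (hw j)) (div_nonneg hnum hden.le)
  have hf : ∀ i j, a i * d j - b i * c j + (a j * d i - b j * c i) = T i j := by
    intro i j
    by_cases hi : w i = 0
    · simp [ha, hb, hc, hd, hT, hi]
    by_cases hj : w j = 0
    · simp [ha, hb, hc, hd, hT, hj]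
    obtain ⟨h1, h2⟩ := hgap i hi
    obtain ⟨h3, h4⟩ := hgap j hj
    have h1a : lam i - E ≠ 0 := fun h => by simp [h] at h1
    have h1b : lam i - E' ≠ 0 := fun h => by simp [h] at h1
    have h2a : lam i - F ≠ 0 := fun h => by simp [h] at h2
    have h2b : lam i - F' ≠ 0 := fun h => by simp [h] at h2
    have h3a : lam j - E ≠ 0 := fun h => by simp [h] at h3
    have h3b : lam j - E' ≠ 0 := fun h => by simp [h] at h3
    have h4a : lam j - F ≠ 0 := fun h => by simp [h] at h4
    have h4b : lam j - F' ≠ 0 := fun h => by simp [h] at h4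
    simp only [ha, hb, hc, hd, hT]
    field_simp
    ring
  have hsum : (∑ i, a i) * (∑ j, d j) - (∑ i, b i) * (∑ j, c j) =
      ∑ i, ∑ j, (a i * d j - b i * c j) := by
    rw [Finset.sum_mul_sum, Finset.sum_mul_sum, ← Finset.sum_sub_distrib]
    refine Finset.sum_congr rfl fun i _ => ?_
    rw [← Finset.sum_sub_distrib]
  have hsymm : ∑ i, ∑ j, (a i * d j - b i * c j) = ∑ i, ∑ j, (a j * d i - b j * c i) :=
    Finset.sum_comm
  have h2 : 2 * ((∑ i, a i) * (∑ j, d j) - (∑ i, b i) * (∑ j, c j)) = ∑ i, ∑ j, T i j := by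
    rw [two_mul, hsum]
    nth_rewrite 2 [hsymm]
    rw [← Finset.sum_add_distrib]
    refine Finset.sum_congr rfl fun i _ => ?_
    rw [← Finset.sum_add_distrib]
    exact Finset.sum_congr rfl fun j _ => hf i j
  have hnn : 0 ≤ ∑ i, ∑ j, T i j :=
    Finset.sum_nonneg fun i _ => Finset.sum_nonneg fun j _ => hTnn i j
  linarith [h2, hnn]

/-- **TP₁ of the Cauchy–Gram kernel in a common gap**: if `(λ_j − E)(λ_j − F) > 0` at every node
carrying weight then `0 ≤ K(E,F)`. [folklore] -/
theorem cauchyGram_nonneg {ι : Type*} [Fintype ι] (w lam : ι → ℝ) (hw : ∀ i, 0 ≤ w i)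
    {E F : ℝ} (hgap : ∀ i, w i ≠ 0 → 0 < (lam i - E) * (lam i - F)) :
    0 ≤ ∑ i, w i / ((lam i - E) * (lam i - F)) := by
  refine Finset.sum_nonneg fun i _ => ?_
  by_cases hi : w i = 0
  · simp [hi]
  · exact div_nonneg (hw i) (hgap i hi).le

/-- **Strict TP₁**: if moreover some node carries weight then `0 < K(E,F)`. [folklore] -/
theorem cauchyGram_pos {ι : Type*} [Fintype ι] (w lam : ι → ℝ) (hw : ∀ i, 0 ≤ w i)
    {E F : ℝ} (hgap : ∀ i, w i ≠ 0 → 0 < (lam i - E) * (lam i - F)) (hne : ∃ i, w i ≠ 0) :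
    0 < ∑ i, w i / ((lam i - E) * (lam i - F)) := by
  obtain ⟨i₀, hi₀⟩ := hne
  have hle : ∀ i ∈ (Finset.univ : Finset ι), 0 ≤ w i / ((lam i - E) * (lam i - F)) := by
    intro i _
    by_cases hi : w i = 0
    · simp [hi]
    · exact div_nonneg (hw i) (hgap i hi).le
  exact lt_of_lt_of_le (div_pos (lt_of_le_of_ne (hw i₀) (Ne.symm hi₀)) (hgap i₀ hi₀))
    (Finset.single_le_sum hle (Finset.mem_univ i₀))

/-- **The bottom-of-spectrum column** (`Δ = 1` end point of the two-magnon curve): for nodes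
`λ_j ≥ 0`… precisely, if every node carrying weight is either `0` or exceeds `ε, ε', F`, and
`0 < ε' ≤ ε`, then `ε' K(ε', F) ≤ ε K(ε, F)`:
termwise `w λ (ε − ε') / ((λ − ε)(λ − ε')(λ − F)) ≥ 0`. [folklore] -/
theorem cauchyGram_mul_mono {ι : Type*} [Fintype ι] (w lam : ι → ℝ) (hw : ∀ i, 0 ≤ w i)
    {ε ε' F : ℝ} (hε' : 0 < ε') (hεε : ε' ≤ ε) (hF : 0 < F)
    (hgap : ∀ i, w i ≠ 0 → lam i = 0 ∨ (ε < lam i ∧ F < lam i)) :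
    ε' * ∑ i, w i / ((lam i - ε') * (lam i - F)) ≤ ε * ∑ i, w i / ((lam i - ε) * (lam i - F)) := by
  rw [Finset.mul_sum, Finset.mul_sum]
  refine Finset.sum_le_sum fun i _ => ?_
  by_cases hi : w i = 0
  · simp [hi]
  rcases hgap i hi with h0 | ⟨h1, h2⟩
  · rw [h0, zero_sub, zero_sub, zero_sub, neg_mul_neg, neg_mul_neg]
    have hε : 0 < ε := lt_of_lt_of_le hε' hεε
    rw [mul_div_assoc', mul_div_assoc', div_le_div_iff₀ (mul_pos hε' hF) (mul_pos hε hF)]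
    nlinarith [hw i]
  · have hd1 : 0 < lam i - ε := sub_pos.2 h1
    have hd1' : 0 < lam i - ε' := by linarith
    have hd2 : 0 < lam i - F := sub_pos.2 h2
    rw [mul_div_assoc', mul_div_assoc',
      div_le_div_iff₀ (mul_pos hd1' hd2) (mul_pos hd1 hd2)]
    have hlam : 0 ≤ lam i := by linarith
    have key : ε' * w i * ((lam i - ε) * (lam i - F)) ≤ ε * w i * ((lam i - ε') * (lam i - F)) := by
      have h3 : ε' * (lam i - ε) ≤ ε * (lam i - ε') := by nlinarith
      have h4 : 0 ≤ w i * (lam i - F) := mul_nonneg (hw i) hd2.le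
      nlinarith [mul_le_mul_of_nonneg_right h3 h4]
    linarith [key]

/-! ### Real symmetric matrices: the resolvent curve `(J − E) g_E = v` -/

section RealSymmetric

variable {ι : Type*} [Fintype ι] [DecidableEq ι]

omit [Fintype ι] [DecidableEq ι] in
/-- Over `ℝ`, the star of a matrix is its transpose. [folklore] -/
theorem star_eq_transpose_real (U : Matrix ι ι ℝ) : star U = Uᵀ := by
  ext i j
  simp [Matrix.star_apply]

/-- Columns of `eigenvectorUnitary` are eigenvectors: `J U = U diag(λ)`. [folklore] -/
theorem mul_eigenvectorUnitary (J : Matrix ι ι ℝ) (hJ : J.IsHermitian) :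
    J * (hJ.eigenvectorUnitary : Matrix ι ι ℝ) =
      (hJ.eigenvectorUnitary : Matrix ι ι ℝ) * diagonal hJ.eigenvalues := by
  ext i j
  have h := congrFun (hJ.mulVec_eigenvectorBasis j) i
  simp only [Matrix.mulVec, dotProduct, Pi.smul_apply, smul_eq_mul] at h
  rw [Matrix.mul_diagonal, Matrix.mul_apply]
  simp only [Matrix.IsHermitian.eigenvectorUnitary_apply]
  rw [h]
  ring

/-- In eigen-coordinates `y = U⋆ g` the resolvent equation `(J − X) g = v` reads
`(λ_i − X) y_i = (U⋆ v)_i`. [folklore] -/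
theorem eigenCoord_resolvent (J : Matrix ι ι ℝ) (hJ : J.IsHermitian) (v : ι → ℝ) (X : ℝ)
    (g : ι → ℝ) (hg : (J - X • (1 : Matrix ι ι ℝ)) *ᵥ g = v) (i : ι) :
    (hJ.eigenvalues i - X) * ((star (hJ.eigenvectorUnitary : Matrix ι ι ℝ)) *ᵥ g) i =
      ((star (hJ.eigenvectorUnitary : Matrix ι ι ℝ)) *ᵥ v) i := by
  set U : Matrix ι ι ℝ := (hJ.eigenvectorUnitary : Matrix ι ι ℝ) with hU
  have hUU : star U * U = 1 := Unitary.coe_star_mul_self hJ.eigenvectorUnitary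
  have hUU' : U * star U = 1 := Unitary.coe_mul_star_self hJ.eigenvectorUnitary
  have hJU : J * U = U * diagonal hJ.eigenvalues := mul_eigenvectorUnitary J hJ
  have h2 : star U * J = diagonal hJ.eigenvalues * star U := by
    calc star U * J = star U * J * (U * star U) := by rw [hUU', Matrix.mul_one]
      _ = star U * (J * U) * star U := by simp only [Matrix.mul_assoc]
      _ = star U * (U * diagonal hJ.eigenvalues) * star U := by rw [hJU]
      _ = (star U * U) * diagonal hJ.eigenvalues * star U := by simp only [Matrix.mul_assoc]
      _ = diagonal hJ.eigenvalues * star U := by rw [hUU, Matrix.one_mul]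
  have h1 : star U *ᵥ ((J - X • (1 : Matrix ι ι ℝ)) *ᵥ g) = star U *ᵥ v := by rw [hg]
  rw [Matrix.mulVec_mulVec, Matrix.mul_sub, h2, Matrix.sub_mulVec, ← Matrix.mulVec_mulVec] at h1
  have h3 := congrFun h1 i
  simp only [Pi.sub_apply, Matrix.mulVec_diagonal, Matrix.mul_smul, Matrix.mul_one,
    Matrix.smul_mulVec, Pi.smul_apply, smul_eq_mul] at h3
  linarith [h3]

/-- Dot products are computed in eigen-coordinates: `g ⬝ g' = (U⋆ g) ⬝ (U⋆ g')`. [folklore] -/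
theorem dotProduct_eigenCoord (J : Matrix ι ι ℝ) (hJ : J.IsHermitian) (g g' : ι → ℝ) :
    g ⬝ᵥ g' = ((star (hJ.eigenvectorUnitary : Matrix ι ι ℝ)) *ᵥ g) ⬝ᵥ
      ((star (hJ.eigenvectorUnitary : Matrix ι ι ℝ)) *ᵥ g') := by
  set U : Matrix ι ι ℝ := (hJ.eigenvectorUnitary : Matrix ι ι ℝ) with hU
  have hUU' : U * star U = 1 := Unitary.coe_mul_star_self hJ.eigenvectorUnitary
  have hg : g = U *ᵥ (star U *ᵥ g) := by
    rw [Matrix.mulVec_mulVec, hUU', Matrix.one_mulVec]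
  conv_lhs => rw [hg]
  rw [dotProduct_comm, Matrix.dotProduct_mulVec, ← Matrix.mulVec_transpose,
    ← star_eq_transpose_real U, dotProduct_comm]

/-- The Gram kernel of the resolvent curve is a Cauchy–Gram kernel: if `(J − X) g = v`,
`(J − Y) g' = v` and `X, Y` avoid the spectrum, then `g ⬝ g' = Σ_i (U⋆v)_i² / ((λ_i − X)(λ_i − Y))`.
[folklore] -/
theorem resolvent_dotProduct_eq_cauchyGram (J : Matrix ι ι ℝ) (hJ : J.IsHermitian) (v : ι → ℝ)
    (X Y : ℝ) (g g' : ι → ℝ) (hg : (J - X • (1 : Matrix ι ι ℝ)) *ᵥ g = v)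
    (hg' : (J - Y • (1 : Matrix ι ι ℝ)) *ᵥ g' = v) (hX : ∀ i, hJ.eigenvalues i - X ≠ 0)
    (hY : ∀ i, hJ.eigenvalues i - Y ≠ 0) :
    g ⬝ᵥ g' = ∑ i, ((star (hJ.eigenvectorUnitary : Matrix ι ι ℝ)) *ᵥ v) i ^ 2 /
      ((hJ.eigenvalues i - X) * (hJ.eigenvalues i - Y)) := by
  rw [dotProduct_eigenCoord J hJ g g']
  unfold dotProduct
  refine Finset.sum_congr rfl fun i _ => ?_
  have h1 := eigenCoord_resolvent J hJ v X g hg i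
  have h2 := eigenCoord_resolvent J hJ v Y g' hg' i
  have e1 : ((star (hJ.eigenvectorUnitary : Matrix ι ι ℝ)) *ᵥ g) i =
      ((star (hJ.eigenvectorUnitary : Matrix ι ι ℝ)) *ᵥ v) i / (hJ.eigenvalues i - X) := by
    rw [eq_div_iff (hX i)]
    linarith [h1]
  have e2 : ((star (hJ.eigenvectorUnitary : Matrix ι ι ℝ)) *ᵥ g') i =
      ((star (hJ.eigenvectorUnitary : Matrix ι ι ℝ)) *ᵥ v) i / (hJ.eigenvalues i - Y) := by
    rw [eq_div_iff (hY i)]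
    linarith [h2]
  rw [e1, e2, div_mul_div_comm, pow_two]

/-- **LEMMA TP₂ (resolvent curves in a common spectral gap; theory seat `ResolventCurveGramTP2`).**
For a real symmetric matrix `J`, a vector `v`, parameters `E ≤ E'` with `(λ_i − E)(λ_i − E') > 0`
and `F ≤ F'` with `(λ_i − F)(λ_i − F') > 0` for every eigenvalue `λ_i`, the solutions of
`(J − E) g_E = v`, … have a TP₂ Gram kernel: `(g_E ⬝ g_F')(g_E' ⬝ g_F) ≤ (g_E ⬝ g_F)(g_E' ⬝ g_F')`.
Karlin (1968) Ch. 3 §1; theory seat memo ROTOR-THEORY-6 §52/§57. [folklore] -/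
theorem resolventCurve_gram_tp2 (J : Matrix ι ι ℝ) (hJ : J.IsHermitian) (v : ι → ℝ)
    {E E' F F' : ℝ} (hE : E ≤ E') (hF : F ≤ F')
    (hgap : ∀ i, 0 < (hJ.eigenvalues i - E) * (hJ.eigenvalues i - E') ∧
      0 < (hJ.eigenvalues i - F) * (hJ.eigenvalues i - F'))
    (gE gE' gF gF' : ι → ℝ)
    (hgE : (J - E • (1 : Matrix ι ι ℝ)) *ᵥ gE = v) (hgE' : (J - E' • (1 : Matrix ι ι ℝ)) *ᵥ gE' = v)
    (hgF : (J - F • (1 : Matrix ι ι ℝ)) *ᵥ gF = v) (hgF' : (J - F' • (1 : Matrix ι ι ℝ)) *ᵥ gF' = v) :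
    (gE ⬝ᵥ gF') * (gE' ⬝ᵥ gF) ≤ (gE ⬝ᵥ gF) * (gE' ⬝ᵥ gF') := by
  have hne : ∀ i, hJ.eigenvalues i - E ≠ 0 ∧ hJ.eigenvalues i - E' ≠ 0 ∧
      hJ.eigenvalues i - F ≠ 0 ∧ hJ.eigenvalues i - F' ≠ 0 := by
    intro i
    obtain ⟨h1, h2⟩ := hgap i
    refine ⟨?_, ?_, ?_, ?_⟩ <;> intro h <;> simp [h] at h1 h2
  rw [resolvent_dotProduct_eq_cauchyGram J hJ v E F' gE gF' hgE hgF'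
      (fun i => (hne i).1) (fun i => (hne i).2.2.2),
    resolvent_dotProduct_eq_cauchyGram J hJ v E' F gE' gF hgE' hgF
      (fun i => (hne i).2.1) (fun i => (hne i).2.2.1),
    resolvent_dotProduct_eq_cauchyGram J hJ v E F gE gF hgE hgF
      (fun i => (hne i).1) (fun i => (hne i).2.2.1),
    resolvent_dotProduct_eq_cauchyGram J hJ v E' F' gE' gF' hgE' hgF'
      (fun i => (hne i).2.1) (fun i => (hne i).2.2.2)]
  exact cauchyGram_minor_nonneg
    (fun i => ((star (hJ.eigenvectorUnitary : Matrix ι ι ℝ)) *ᵥ v) i ^ 2)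
    hJ.eigenvalues (fun i => sq_nonneg _) hE hF (fun i _ => hgap i)

/-- **TP₁ of the resolvent curve in a common gap**: if moreover `(λ_i − E)(λ_i − F) > 0` for all `i`
then `0 ≤ g_E ⬝ g_F`. [folklore] -/
theorem resolventCurve_gram_nonneg (J : Matrix ι ι ℝ) (hJ : J.IsHermitian) (v : ι → ℝ)
    {E F : ℝ} (hgap : ∀ i, 0 < (hJ.eigenvalues i - E) * (hJ.eigenvalues i - F))
    (gE gF : ι → ℝ) (hgE : (J - E • (1 : Matrix ι ι ℝ)) *ᵥ gE = v)
    (hgF : (J - F • (1 : Matrix ι ι ℝ)) *ᵥ gF = v) : 0 ≤ gE ⬝ᵥ gF := by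
  have hne : ∀ i, hJ.eigenvalues i - E ≠ 0 ∧ hJ.eigenvalues i - F ≠ 0 := by
    intro i
    have h1 := hgap i
    refine ⟨?_, ?_⟩ <;> intro h <;> simp [h] at h1
  rw [resolvent_dotProduct_eq_cauchyGram J hJ v E F gE gF hgE hgF
      (fun i => (hne i).1) (fun i => (hne i).2)]
  exact cauchyGram_nonneg _ hJ.eigenvalues (fun i => sq_nonneg _) (fun i _ => hgap i)

end RealSymmetric

end Summit.HubbardSuperconductivity.HubbardSuperconductivity.Theorems.AnisotropyChord
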